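import Literature.NumberTheory.EllipticCurves.Rank1Residual.Typed.X6
import Literature.NumberTheory.EllipticCurves.Rank1Residual.Typed.X7
import Literature.NumberTheory.EllipticCurves.Rank1Residual.Typed.X8
import Literature.NumberTheory.EllipticCurves.Rank1Residual.Typed.KolyvaginCertificate
import Literature.NumberTheory.EllipticCurves.Jetchev2008.HeegnerIndexTamagawaBound
import Literature.NumberTheory.EllipticCurves.ComplexMultiplicationNotSemistable
import Literature.NumberTheory.EllipticCurves.CuspFormLFunctionLevelConductorProofs
import Summits.BirchSwinnertonDyer.BirchSwinnertonDyer.Theorems.Rank1ResidualX9JetchevCha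
import HarnessLib

/-!
# Good supersingular classes X6 / X7 / X8, analytic rank `≤ 1`: the PER-PAIR certificate route through
# Jetchev's Tamagawa sharpening of the Heegner-index bound (Jetchev 2008 Cor. 1.5; Miller 2011 Thm. 5.4)

HONEST FRAMING (cell `b2b-bsdres`, run/shared/lean/b2b/bsd-rank1-residual/, verbatim in every
file): the goal of the cell is to DELETE the COMBINATION-SHAPED residual classes of the
Birch–Swinnerton-Dyer formula for ALL analytic-rank `≤ 1` elliptic curves over `ℚ` — "full BSD
formula for every rank `≤ 1` curve in class `C`" assembled STRICTLY from published theorems — so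
that the rank-`≤ 1` remainder becomes exactly the CONSTRUCTION-SHAPED classes, which are TYPED
(missing-input `Prop`s), NOT attempted. This is not "finishing BSD". Prove what is provable now;
shrink each hard class to its core with data; no claim beyond stated classes. This file is PER
PAIR (certificate shapes), not a class theorem; X6 / X7 / X8 stay CONSTRUCTION-SHAPED; nothing is
booked here (bookings are the referee's, under the lane's two-implementation rule for the index);
no named fact is introduced (theorems only; census/literature seat `b2b-bsdres-harvest-1`, gen 19,
ON CALL for the X6/X7/X8 prover pair `b2b-bsdres-x10b` / `b2b-bsdres-additive-p3`).

## Why this file (census, HOME/b2b-bsdres-harvest-1/g19/x7r1/, RECLASSIFY §GEN-19)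

On the census of record (N < 2·10⁴) the rank-one pairs of X7 (72) and X8 (39) all have a `p`-adic
UNIT analytic order of `Ш` (`v_p(#Ш_an) = 0`), so their typed residue is the one-sided certificate
`Ш(E/ℚ)[p] = 0` (`Typed.missingPPartAt_iff_noPTorsion_of_shaAn_unit`). The tree's producers of that
bit from a Heegner point `y_K` are Kolyvagin's index certificate (`Typed/KolyvaginCertificate.lean`:
`p ∤ [E(K) : ℤ y_K]`) and Matar–Nekovář 2019 Thm. 6.7 (1) (`Supersingular/HeegnerIndexRoute.lean`, same
index condition). By Gross–Zagier and the BSD shape over `K`, `p ∣ c_q(E)` for a bad prime `q`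
FORCES `p ∣ [E(K) : ℤ y_K]` in every Heegner field (57 of the 72 X7 pairs, 26 of the 39 X8 pairs) —
there only a TAMAGAWA-SHARPENED index bound can certify `Ш(E)[p] = 0`. The printed lever is
D. Jetchev, *Global divisibility of Heegner points and Tamagawa numbers*, Compos. Math. 144 (2008)
811–826, Cor. 1.5 — `#Ш(E/K)[p^∞] ≤ p^{2 m₀ − 2 m_max}`, `m₀ = ord_p [E(K) : ℤ y_K]`,
`m_max = max_{q ∣ N} ord_p c_q`, under Hypothesis (∗): `p ∤ N`, `ρ̄_{E,p}` surjective (tree named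
fact `Jetchev2008.cor15_padicValNat_card_primaryComponent_sha_le`, A27, PUB, x10 g3; optimal
parametrisation as the datum `_hopt`) — and R. L. Miller's restatement under Cha's hypotheses,
LMS J. Comput. Math. 14 (2011) Thm. 5.4 (tree named fact
`Miller2011.thm54_cha_padicValNat_shaOrder_add_tamagawa_le`, FLAG `Miller11-Thm54-Cha-case`, x9 g7:
`p ∤ 2 d_K`, `p² ∤ N`, `ρ̄_{E,p}` irreducible, `E` non-CM). At a good supersingular prime both sets
of reduction/image hypotheses are AUTOMATIC or cheap: `p ∤ N` (good reduction — here DERIVED for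
the level `N` of the Heegner datum from `IsNewformOf.dvd_level_iff_dvd_conductorNorm`, a tree
THEOREM, no Carayol input), `E[p]` irreducible (`ClassX7.irr`, `ClassX8.irr'`, `ClassX6.irr`, Serre
1972 Prop. 12), `ρ̄` surjective and `E` non-CM on X6 (`ClassX6.surj`, `ClassX6.not_hasCM`).

So the per-pair input left is the finite certificate: a Heegner field `K`, a Heegner point `P = y_K`
of infinite order, ONE bad prime `q ∣ N` with `ord_p [E(K) : ℤ P] ≤ ord_p c_q(E)` (for Jetchev: at the
`q` attaining `m_max` this is `m₀ ≤ m_max`), and `p ∤ #Ш_an`. Census reading (instrument, kit jobs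
j091235–j091237, `g19/x7r1/`): e.g. `4940b1` at `p = 3` (X7; `c_2 = 3` the only Tamagawa number
divisible by `3`) has the lane-CERTIFIED index `m = 12` at `K = ℚ(√−471)` and `m = 48` at
`ℚ(√−231)` (`ord_3 m = 1 = ord_3 c_2`), so Cor. 1.5 gives `Ш(E/K)[3^∞] = 0` there — a pair the lane's
first-field bound (`D = −79`, `ord_3 m = 2`) had left at `ord_3 #Ш ≤ 2`. Nothing is booked by this
file; which pairs carry a two-implementation certificate is the lane's and the referee's call.

## Contents (theorems only)
* §0 generic: `noPTorsion_of_jetchevTamagawaCertificate`, `bsdp_of_jetchevTamagawaCertificate`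
  — the A27 (surjective) form: Jetchev's bound at `ord_p index ≤ ord_p c_q` kills `Ш(E/K)[p^∞]`
  (Kolyvagin's finiteness `kolyvagin`), hence `Ш(E/ℚ)[p]` (restriction is injective on `p`-torsion
  for `p` odd, `injOn_shaRestriction_torsionBy`), hence `BSD(E,p)` at a `p`-unit `#Ш_an`
  (`Typed.bsdp_of_shaAn_unit_of_noPTorsion`); `not_dvd_level_of_isHeegnerPoint_of_good` — `p ∤ N`
  for the level of any Heegner datum at a good prime.
* §1 X7: `X7.bsdp_of_jetchev_of_index_le_tamagawa` (binder `Surj W p` — NOT automatic on X7),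
  `X7.bsdp_of_millerJetchev_of_index_le_tamagawa` (Miller–Cha form: binders `¬ W.HasCM`, `p ∤ d_K`;
  `irr` automatic), `X7.missingInputAt_of_jetchev_of_index_le_tamagawa` (typed currency).
* §2 X8 (`p = 3`): `X8.bsdp_of_jetchev_of_index_le_tamagawa`, `X8.bsdp_of_millerJetchev_of_index_le_tamagawa`.
* §3 X6: `X6.bsdp_of_jetchev_of_index_le_tamagawa` (surjectivity AUTOMATIC),
  `X6.bsdp_of_millerJetchev_of_index_le_tamagawa` (non-CM and irreducibility AUTOMATIC).

References: D. Jetchev, Compos. Math. 144 (2008) 811–826, Hypothesis (∗), Thm. 1.4, Cor. 1.5 (p. 3)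
[Jetchev2008]; R. L. Miller, LMS J. Comput. Math. 14 (2011), Thm. 5.4, Def. 1.1 [Miller2011LMS];
V. A. Kolyvagin, *Euler systems* (1990) Thm. A [KolyvaginEulerSystems1990]; B. H. Gross, LMS LN 153
(1991) Thm. 1.3 [GrossLMS1991]; J.-P. Serre, Invent. Math. 15 (1972) §1.11 Prop. 12, §5.4 Prop. 21
[Serre1972]; F. Diamond, J. Shurman, GTM 228, Prop. 5.8.5 / (8.44) [DiamondShurman2005];
RESIDUAL-CASES.md §a.2 X6/X7/X8; CLASS-OWNERS.md rows X6–X8.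
-/

noncomputable section

open scoped Classical

open WeierstrassCurve Literature.NumberTheory.EllipticCurves
  Literature.NumberTheory.EllipticCurves.ModularForms
  Literature.NumberTheory.EllipticCurves.Rank1Residual
  Literature.NumberTheory.EllipticCurves.Rank1Residual.Typed
  Literature.NumberTheory.EllipticCurves.Miller2011
  Summit.BirchSwinnertonDyer.BirchSwinnertonDyer.Rank1Residual

namespace Summit.BirchSwinnertonDyer.Rank1Residual.Supersingular

variable (W : WeierstrassCurve ℚ) [W.IsElliptic] [W.IsGloballyMinimal] (p : ℕ) [hp : Fact p.Prime]

/-! ## §0 Generic: Jetchev's Cor. 1.5 at `ord_p [E(K) : ℤ y_K] ≤ ord_p c_q` -/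

omit [W.IsGloballyMinimal] in
/-- **`p ∤ N` for the level `N` of any Heegner datum of `E` at a prime of good reduction** — the
parametrisation datum inside `IsHeegnerPoint N W K P` carries a newform `f ∈ S₂(Γ₀(N))` with
`aₙ(f) = aₙ(E)`, whose level has the same prime divisors as the conductor (tree theorem
`IsNewformOf.dvd_level_iff_dvd_conductorNorm`, `q`-expansion arithmetic, no Carayol input), and
`p ∤ N_E` at a good prime (`WeierstrassCurve.dvd_conductorNorm_iff_not_hasGoodReductionAtPrime`).
[cite: DiamondShurman2005, Prop. 5.8.5 and (8.44), §8.3] -/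
theorem not_dvd_level_of_isHeegnerPoint_of_good {N : ℕ} [NeZero N] {K : Type} [Field K]
    [NumberField K] {P : (W.baseChange K).toAffine.Point} (hP : IsHeegnerPoint N W K P)
    (hgood : W.HasGoodReductionAtPrime p) : ¬ p ∣ N := by
  obtain ⟨Dt, -, -, -⟩ := hP
  rw [Dt.isNewformOf.dvd_level_iff_dvd_conductorNorm hp.out,
    W.dvd_conductorNorm_iff_not_hasGoodReductionAtPrime p, not_not]
  exact hgood

omit [W.IsGloballyMinimal] in
/-- **Jetchev's Tamagawa-sharpened index certificate gives `Ш(E/ℚ)[p] = 0`.** For `E/ℚ`, an odd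
prime `p ∤ N` with `ρ̄_{E,p}` surjective, an imaginary quadratic `K` (`d_K ≠ −3`) with the Heegner
hypothesis for the level `N`, an optimal parametrisation datum (`hopt`), a Heegner point `P = y_K` of
infinite order and ONE prime `q ∣ N` with `ord_p [E(K) : ℤ P] ≤ ord_p c_q(E)`: Jetchev 2008 Cor. 1.5
(`hJ`, in the tree's monotone form `ord_p #Ш(E/K)[p^∞] + 2 ord_p c_q ≤ 2 ord_p [E(K) : ℤ P]`) forces
`ord_p #Ш(E/K)[p^∞] = 0`; `Ш(E/K)` is finite (Kolyvagin, `hKo`), so `p ∤ #Ш(E/K)`, and restriction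
`Ш(E/ℚ) → Ш(E/K)` is injective on `Ш(E/ℚ)[p]` (`p` odd, `[K : ℚ] = 2`). Per curve; nothing booked.
[cite: Jetchev2008, Hypothesis (*), Cor. 1.5 (p. 3)] [cite: GrossLMS1991, §1 Thm. 1.3] -/
theorem noPTorsion_of_jetchevTamagawaCertificate {N : ℕ} [NeZero N] {K : Type} [Field K]
    [NumberField K] (hKo : kolyvagin N W K)
    (hJ : Jetchev2008.cor15_padicValNat_card_primaryComponent_sha_le)
    (hK : IsImaginaryQuadratic K) (hD3 : NumberField.discr K ≠ -3)
    (hH : SatisfiesHeegnerHypothesis N K)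
    (hopt : ∃ Dt : ModularParametrizationData W N,
      ∀ z ∈ Dt.L.lattice, ∃ w ∈ periodLattice Dt.f, z = (Dt.c : ℂ) * w)
    {P : (W.baseChange K).toAffine.Point} (hP : IsHeegnerPoint N W K P) (hnt : ¬ IsOfFinAddOrder P)
    (hp2 : p ≠ 2) (hpN : ¬ p ∣ N) (hρ : W.HasSurjectiveModNGaloisRep p)
    (q : ℕ) [Fact q.Prime] (hqN : q ∣ N)
    (hI : padicValNat p (AddSubgroup.zmultiples P).index ≤
      padicValNat p ((W.baseChange ℚ_[q]).localTamagawaNumber ℤ_[q])) :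
    ∀ x : W.sha, (p : ℤ) • x = 0 → x = 0 := by
  have hpp : p.Prime := hp.out
  obtain ⟨-, hfinK⟩ := hKo hK hH hP hnt
  haveI : Finite (W.baseChange K).sha := hfinK
  have hb := hJ N W K hK hD3 hH hopt hP hnt p hp2 hpN hρ q hqN
  have h0' : padicValNat p (Nat.card (AddCommGroup.primaryComponent (W.baseChange K).sha p)) = 0 := by
    omega
  have h0 : padicValNat p (Nat.card (W.baseChange K).sha) = 0 := by
    rwa [padicValNat_card_addPrimaryComponent (A := (W.baseChange K).sha) p] at h0'
  have hndvd : ¬ p ∣ Nat.card (W.baseChange K).sha := by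
    rcases padicValNat.eq_zero_iff.mp h0 with h1 | h0'' | hnd
    · exact absurd h1 hpp.one_lt.ne'
    · exact absurd h0'' Nat.card_pos.ne'
    · exact hnd
  haveI : IsGalois ℚ K := by
    haveI : Algebra.IsQuadraticExtension ℚ K := ⟨hK.1⟩
    infer_instance
  have hcop : p.Coprime (Module.finrank ℚ K) := by
    rw [hK.1]
    exact (Nat.coprime_primes hpp Nat.prime_two).mpr hp2
  intro x hx
  have hxn : p • x = 0 := by rw [← natCast_zsmul]; exact hx
  have hres : shaRestriction W K x = 0 := by
    have hpr : p • shaRestriction W K x = 0 := by rw [← map_nsmul, hxn, map_zero]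
    have hdiv : addOrderOf (shaRestriction W K x) ∣ p := addOrderOf_dvd_of_nsmul_eq_zero hpr
    rcases (Nat.dvd_prime hpp).mp hdiv with h1 | hp'
    · exact AddMonoid.addOrderOf_eq_one_iff.mp h1
    · exact absurd (hp' ▸ addOrderOf_dvd_natCard (shaRestriction W K x)) hndvd
  have hx_mem : x ∈ (AddSubgroup.torsionBy W.sha p : Set W.sha) :=
    AddSubgroup.torsionBy.nsmul_iff.mpr hxn
  have h0_mem : (0 : W.sha) ∈ (AddSubgroup.torsionBy W.sha p : Set W.sha) :=
    AddSubgroup.torsionBy.nsmul_iff.mpr (smul_zero _)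
  exact injOn_shaRestriction_torsionBy W K hcop hx_mem h0_mem (by rw [hres, map_zero])

omit [W.IsGloballyMinimal] in
/-- **`BSD(E,p)` from Jetchev's Tamagawa-sharpened index certificate at a pair with `p ∤ #Ш_an`**
(analytic rank `≤ 1`; binders: Jetchev 2008 Cor. 1.5 `hJ` [A27, PUB], Kolyvagin's finiteness `hKo`,
GZK `hGZK`; the certificate: `K` (`d_K ≠ −3`, Heegner hypothesis for `N`), an optimal parametrisation
datum, `P = y_K` of infinite order, `p` odd with `p ∤ N` and `ρ̄_{E,p}` surjective, one `q ∣ N` with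
`ord_p [E(K) : ℤ P] ≤ ord_p c_q`, and `#Ш_an = s` with `ord_p s = 0`). Per curve; not a class
theorem. [cite: Jetchev2008, Cor. 1.5 (p. 3)] [cite: Miller2011LMS, §1 and Def. 1.1] -/
theorem bsdp_of_jetchevTamagawaCertificate {N : ℕ} [NeZero N] {K : Type} [Field K]
    [NumberField K] (hKo : kolyvagin N W K)
    (hJ : Jetchev2008.cor15_padicValNat_card_primaryComponent_sha_le)
    (hGZK : rank_eq_analyticRank_of_analyticRank_le_one)
    (hK : IsImaginaryQuadratic K) (hD3 : NumberField.discr K ≠ -3)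
    (hH : SatisfiesHeegnerHypothesis N K)
    (hopt : ∃ Dt : ModularParametrizationData W N,
      ∀ z ∈ Dt.L.lattice, ∃ w ∈ periodLattice Dt.f, z = (Dt.c : ℂ) * w)
    {P : (W.baseChange K).toAffine.Point} (hP : IsHeegnerPoint N W K P) (hnt : ¬ IsOfFinAddOrder P)
    (hp2 : p ≠ 2) (hpN : ¬ p ∣ N) (hρ : W.HasSurjectiveModNGaloisRep p)
    (q : ℕ) [Fact q.Prime] (hqN : q ∣ N)
    (hI : padicValNat p (AddSubgroup.zmultiples P).index ≤
      padicValNat p ((W.baseChange ℚ_[q]).localTamagawaNumber ℤ_[q]))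
    (hr : W.analyticRank ≤ 1) {s : ℚ} (hs : shaAn W = (s : ℂ)) (hv : padicValRat p s = 0) :
    BSDp W p :=
  Typed.bsdp_of_shaAn_unit_of_noPTorsion W p hGZK hr hs hv
    (noPTorsion_of_jetchevTamagawaCertificate W p hKo hJ hK hD3 hH hopt hP hnt hp2 hpN hρ q hqN hI)

/-! ## §1 Class X7 (good supersingular, `E` not semistable) -/

/-- **X7: `BSD(E,p)` from Jetchev 2008 Cor. 1.5 and a Tamagawa-sharpened index certificate.** For an
X7 pair `(E, p)` (`ClassX7 W p`: good supersingular at `p`, `E` not semistable) with `p ≠ 2`,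
`ρ̄_{E,p}` surjective (`hsurj` — NOT automatic on X7: `E` has an additive prime) and analytic rank
`≤ 1`: granted A27 (`hJ`), Kolyvagin (`hKo`) and GZK, the per-pair inputs are `K` (`d_K ≠ −3`,
Heegner hypothesis for `N`), an optimal parametrisation datum, `P = y_K` of infinite order, one
`q ∣ N` with `ord_p [E(K) : ℤ P] ≤ ord_p c_q(E)`, and `#Ш_an` a `p`-adic unit; `p ∤ N` is DERIVED
(`not_dvd_level_of_isHeegnerPoint_of_good`). Per pair; nothing booked.
[cite: Jetchev2008, Cor. 1.5 (p. 3)] [cite: Miller2011LMS, §1 and Def. 1.1] -/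
theorem X7.bsdp_of_jetchev_of_index_le_tamagawa {N : ℕ} [NeZero N] {K : Type} [Field K]
    [NumberField K] (hKo : kolyvagin N W K)
    (hJ : Jetchev2008.cor15_padicValNat_card_primaryComponent_sha_le)
    (hGZK : rank_eq_analyticRank_of_analyticRank_le_one)
    (hX : ClassX7 W p) (hp2 : p ≠ 2) (hsurj : Surj W p) (hr : W.analyticRank ≤ 1)
    (hK : IsImaginaryQuadratic K) (hD3 : NumberField.discr K ≠ -3)
    (hH : SatisfiesHeegnerHypothesis N K)
    (hopt : ∃ Dt : ModularParametrizationData W N,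
      ∀ z ∈ Dt.L.lattice, ∃ w ∈ periodLattice Dt.f, z = (Dt.c : ℂ) * w)
    {P : (W.baseChange K).toAffine.Point} (hP : IsHeegnerPoint N W K P) (hnt : ¬ IsOfFinAddOrder P)
    (q : ℕ) [Fact q.Prime] (hqN : q ∣ N)
    (hI : padicValNat p (AddSubgroup.zmultiples P).index ≤
      padicValNat p ((W.baseChange ℚ_[q]).localTamagawaNumber ℤ_[q]))
    {s : ℚ} (hs : shaAn W = (s : ℂ)) (hv : padicValRat p s = 0) : BSDp W p :=
  bsdp_of_jetchevTamagawaCertificate W p hKo hJ hGZK hK hD3 hH hopt hP hnt hp2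
    (not_dvd_level_of_isHeegnerPoint_of_good W p hP hX.1.1) hsurj q hqN hI hr hs hv

/-- **X7: the Miller–Cha form** (no optimality datum, no surjectivity; instead `E` non-CM (`hcm`) and
`p ∤ d_K`): Miller 2011 Thm. 5.4 under Cha's hypotheses (`hMJ`, FLAG `Miller11-Thm54-Cha-case`) with
`E[p]` irreducible AUTOMATIC (`ClassX7.irr`, Serre Prop. 12) and `p² ∤ N` DERIVED from good reduction.
Certificate: `K`, `P = y_K` of infinite order, one `q ∣ N` with `ord_p [E(K) : ℤ P] ≤ ord_p c_q(E)`,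
`#Ш_an` a `p`-adic unit. Per pair; nothing booked. [cite: Miller2011LMS, Thm. 5.4 and Def. 1.1]
[cite: Jetchev2008, Cor. 1.5 (p. 3)] [cite: Serre1972, §1.11 Prop. 12] -/
theorem X7.bsdp_of_millerJetchev_of_index_le_tamagawa
    (hMJ : thm54_cha_padicValNat_shaOrder_add_tamagawa_le)
    (hGZK : rank_eq_analyticRank_of_analyticRank_le_one)
    (hX : ClassX7 W p) (hp2 : p ≠ 2) (hcm : ¬ W.HasCM) (hr : W.analyticRank ≤ 1)
    {N : ℕ} [NeZero N] {K : Type} [Field K] [NumberField K] (hK : IsImaginaryQuadratic K)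
    (hH : SatisfiesHeegnerHypothesis N K) {P : (W.baseChange K).toAffine.Point}
    (hP : IsHeegnerPoint N W K P) (hnt : ¬ IsOfFinAddOrder P)
    (hpD : ¬ (p : ℤ) ∣ NumberField.discr K) (q : ℕ) [Fact q.Prime] (hqN : q ∣ N)
    (hI : padicValNat p (AddSubgroup.zmultiples P).index ≤
      padicValNat p ((W.baseChange ℚ_[q]).localTamagawaNumber ℤ_[q]))
    {s : ℚ} (hs : shaAn W = (s : ℂ)) (hv : padicValRat p s = 0) : BSDp W p :=
  _root_.Summit.BirchSwinnertonDyer.BirchSwinnertonDyer.Rank1Residual.bsdp_of_millerJetchev_of_index_le_tamagawa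
    hMJ hGZK W p hK hH hP hnt q hqN hcm hp2 hpD
    (fun h ↦ not_dvd_level_of_isHeegnerPoint_of_good W p hP hX.1.1 (dvd_trans (dvd_pow_self p two_ne_zero) h))
    (ClassX7.irr W p hp2 hX) hI hr hs hv

/-- … and X7's typed residue follows at such a pair (Jetchev form). Bookkeeping; nothing asserted.
[cite: Jetchev2008, Cor. 1.5 (p. 3)] [cite: Miller2011LMS, Def. 1.1] -/
theorem X7.missingInputAt_of_jetchev_of_index_le_tamagawa {N : ℕ} [NeZero N] {K : Type} [Field K]
    [NumberField K] (hKo : kolyvagin N W K)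
    (hJ : Jetchev2008.cor15_padicValNat_card_primaryComponent_sha_le)
    (hGZK : rank_eq_analyticRank_of_analyticRank_le_one)
    (hX : ClassX7 W p) (hp2 : p ≠ 2) (hsurj : Surj W p) (hr : W.analyticRank ≤ 1)
    (hK : IsImaginaryQuadratic K) (hD3 : NumberField.discr K ≠ -3)
    (hH : SatisfiesHeegnerHypothesis N K)
    (hopt : ∃ Dt : ModularParametrizationData W N,
      ∀ z ∈ Dt.L.lattice, ∃ w ∈ periodLattice Dt.f, z = (Dt.c : ℂ) * w)
    {P : (W.baseChange K).toAffine.Point} (hP : IsHeegnerPoint N W K P) (hnt : ¬ IsOfFinAddOrder P)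
    (q : ℕ) [Fact q.Prime] (hqN : q ∣ N)
    (hI : padicValNat p (AddSubgroup.zmultiples P).index ≤
      padicValNat p ((W.baseChange ℚ_[q]).localTamagawaNumber ℤ_[q]))
    {s : ℚ} (hs : shaAn W = (s : ℂ)) (hv : padicValRat p s = 0) : X7.MissingInputAt W p := by
  obtain ⟨-, hfin⟩ := hGZK W hr
  haveI : Finite W.sha := hfin
  have hB := X7.bsdp_of_jetchev_of_index_le_tamagawa W p hKo hJ hGZK hX hp2 hsurj hr hK hD3 hH hopt
    hP hnt q hqN hI hs hv
  have hPP := missingPPartAt_of_bsdp W p hB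
  exact ⟨fun _ _ _ ↦ (lower_and_upper_of_missingPPartAt W p hPP).1, fun _ ↦ hPP⟩

/-! ## §2 Class X8 (`p = 3` good supersingular, `a_3 = ±3`) -/

/-- **X8: `BSD(E,3)` from Jetchev 2008 Cor. 1.5 and a Tamagawa-sharpened index certificate**
(`ClassX8 W p`: `p = 3`, good supersingular at `3`, `a_3 ≠ 0`; `ρ̄_{E,3}` surjective is the binder
`hsurj`; `3 ∤ N` DERIVED from good reduction). Certificate as in §1. Per pair; nothing booked.
[cite: Jetchev2008, Cor. 1.5 (p. 3)] [cite: Miller2011LMS, §1 and Def. 1.1] -/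
theorem X8.bsdp_of_jetchev_of_index_le_tamagawa {N : ℕ} [NeZero N] {K : Type} [Field K]
    [NumberField K] (hKo : kolyvagin N W K)
    (hJ : Jetchev2008.cor15_padicValNat_card_primaryComponent_sha_le)
    (hGZK : rank_eq_analyticRank_of_analyticRank_le_one)
    (hX : ClassX8 W p) (hsurj : Surj W p) (hr : W.analyticRank ≤ 1)
    (hK : IsImaginaryQuadratic K) (hD3 : NumberField.discr K ≠ -3)
    (hH : SatisfiesHeegnerHypothesis N K)
    (hopt : ∃ Dt : ModularParametrizationData W N,
      ∀ z ∈ Dt.L.lattice, ∃ w ∈ periodLattice Dt.f, z = (Dt.c : ℂ) * w)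
    {P : (W.baseChange K).toAffine.Point} (hP : IsHeegnerPoint N W K P) (hnt : ¬ IsOfFinAddOrder P)
    (q : ℕ) [Fact q.Prime] (hqN : q ∣ N)
    (hI : padicValNat p (AddSubgroup.zmultiples P).index ≤
      padicValNat p ((W.baseChange ℚ_[q]).localTamagawaNumber ℤ_[q]))
    {s : ℚ} (hs : shaAn W = (s : ℂ)) (hv : padicValRat p s = 0) : BSDp W p := by
  obtain ⟨rfl, hss, -⟩ := hX
  exact bsdp_of_jetchevTamagawaCertificate W 3 hKo hJ hGZK hK hD3 hH hopt hP hnt (by decide)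
    (not_dvd_level_of_isHeegnerPoint_of_good W 3 hP hss.1) hsurj q hqN hI hr hs hv

/-- **X8: the Miller–Cha form** (`E` non-CM `hcm`, `3 ∤ d_K`; `E[3]` irreducible AUTOMATIC
`ClassX8.irr'`; `9 ∤ N` DERIVED; FLAG `Miller11-Thm54-Cha-case` on `hMJ`). Per pair; nothing booked.
[cite: Miller2011LMS, Thm. 5.4 and Def. 1.1] [cite: Serre1972, §1.11 Prop. 12] -/
theorem X8.bsdp_of_millerJetchev_of_index_le_tamagawa
    (hMJ : thm54_cha_padicValNat_shaOrder_add_tamagawa_le)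
    (hGZK : rank_eq_analyticRank_of_analyticRank_le_one)
    (hX : ClassX8 W p) (hcm : ¬ W.HasCM) (hr : W.analyticRank ≤ 1)
    {N : ℕ} [NeZero N] {K : Type} [Field K] [NumberField K] (hK : IsImaginaryQuadratic K)
    (hH : SatisfiesHeegnerHypothesis N K) {P : (W.baseChange K).toAffine.Point}
    (hP : IsHeegnerPoint N W K P) (hnt : ¬ IsOfFinAddOrder P)
    (hpD : ¬ (p : ℤ) ∣ NumberField.discr K) (q : ℕ) [Fact q.Prime] (hqN : q ∣ N)
    (hI : padicValNat p (AddSubgroup.zmultiples P).index ≤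
      padicValNat p ((W.baseChange ℚ_[q]).localTamagawaNumber ℤ_[q]))
    {s : ℚ} (hs : shaAn W = (s : ℂ)) (hv : padicValRat p s = 0) : BSDp W p := by
  have hirr : Irr W p := ClassX8.irr' W p hX
  obtain ⟨rfl, hss, -⟩ := hX
  exact _root_.Summit.BirchSwinnertonDyer.BirchSwinnertonDyer.Rank1Residual.bsdp_of_millerJetchev_of_index_le_tamagawa
    hMJ hGZK W 3 hK hH hP hnt q hqN hcm (by decide) hpD
    (fun h ↦ not_dvd_level_of_isHeegnerPoint_of_good W 3 hP hss.1
      (dvd_trans (dvd_pow_self 3 two_ne_zero) h)) hirr hI hr hs hv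

/-! ## §3 Class X6 (good supersingular, semistable, `p ≥ 5 ∨ a_3 = 0`): every image / CM hypothesis automatic -/

/-- **X6: `BSD(E,p)` from Jetchev 2008 Cor. 1.5 and a Tamagawa-sharpened index certificate, NO image
input** — on X6 at an odd `p`, `ρ̄_{E,p}` is surjective (`ClassX6.surj`: Serre Props. 12 / 21 i)) and
`p ∤ N` is derived; what remains per pair is `K` (`d_K ≠ −3`), the optimal parametrisation datum,
`P = y_K` of infinite order, one `q ∣ N` with `ord_p [E(K) : ℤ P] ≤ ord_p c_q(E)`, and a `p`-unit
`#Ш_an`. Per pair; nothing booked (X6's rank-one half is not residual on the census; recorded for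
completeness and for rank `0` pairs reached through `r_an ≤ 1`).
[cite: Jetchev2008, Cor. 1.5 (p. 3)] [cite: Serre1972, §5.4 Prop. 21 i)] [cite: Miller2011LMS, §1 and Def. 1.1] -/
theorem X6.bsdp_of_jetchev_of_index_le_tamagawa {N : ℕ} [NeZero N] {K : Type} [Field K]
    [NumberField K] (hKo : kolyvagin N W K)
    (hJ : Jetchev2008.cor15_padicValNat_card_primaryComponent_sha_le)
    (hGZK : rank_eq_analyticRank_of_analyticRank_le_one)
    (hX : ClassX6 W p) (hp2 : p ≠ 2) (hr : W.analyticRank ≤ 1)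
    (hK : IsImaginaryQuadratic K) (hD3 : NumberField.discr K ≠ -3)
    (hH : SatisfiesHeegnerHypothesis N K)
    (hopt : ∃ Dt : ModularParametrizationData W N,
      ∀ z ∈ Dt.L.lattice, ∃ w ∈ periodLattice Dt.f, z = (Dt.c : ℂ) * w)
    {P : (W.baseChange K).toAffine.Point} (hP : IsHeegnerPoint N W K P) (hnt : ¬ IsOfFinAddOrder P)
    (q : ℕ) [Fact q.Prime] (hqN : q ∣ N)
    (hI : padicValNat p (AddSubgroup.zmultiples P).index ≤
      padicValNat p ((W.baseChange ℚ_[q]).localTamagawaNumber ℤ_[q]))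
    {s : ℚ} (hs : shaAn W = (s : ℂ)) (hv : padicValRat p s = 0) : BSDp W p :=
  bsdp_of_jetchevTamagawaCertificate W p hKo hJ hGZK hK hD3 hH hopt hP hnt hp2
    (not_dvd_level_of_isHeegnerPoint_of_good W p hP hX.1.1) (ClassX6.surj W p hp2 hX) q hqN hI hr
    hs hv

/-- **X6: the Miller–Cha form, NO image and NO CM input** — `E[p]` irreducible (`ClassX6.irr`),
`E` non-CM (`ClassX6.not_hasCM`: a CM curve is never semistable) and `p² ∤ N` are automatic /
derived; per pair: `K` with `p ∤ d_K`, `P = y_K` of infinite order, one `q ∣ N` with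
`ord_p [E(K) : ℤ P] ≤ ord_p c_q(E)`, a `p`-unit `#Ш_an`. FLAG `Miller11-Thm54-Cha-case` on `hMJ`.
Per pair; nothing booked. [cite: Miller2011LMS, Thm. 5.4 and Def. 1.1] [cite: Serre1972, §1.11 Prop. 12] -/
theorem X6.bsdp_of_millerJetchev_of_index_le_tamagawa
    (hMJ : thm54_cha_padicValNat_shaOrder_add_tamagawa_le)
    (hGZK : rank_eq_analyticRank_of_analyticRank_le_one)
    (hX : ClassX6 W p) (hp2 : p ≠ 2) (hr : W.analyticRank ≤ 1)
    {N : ℕ} [NeZero N] {K : Type} [Field K] [NumberField K] (hK : IsImaginaryQuadratic K)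
    (hH : SatisfiesHeegnerHypothesis N K) {P : (W.baseChange K).toAffine.Point}
    (hP : IsHeegnerPoint N W K P) (hnt : ¬ IsOfFinAddOrder P)
    (hpD : ¬ (p : ℤ) ∣ NumberField.discr K) (q : ℕ) [Fact q.Prime] (hqN : q ∣ N)
    (hI : padicValNat p (AddSubgroup.zmultiples P).index ≤
      padicValNat p ((W.baseChange ℚ_[q]).localTamagawaNumber ℤ_[q]))
    {s : ℚ} (hs : shaAn W = (s : ℂ)) (hv : padicValRat p s = 0) : BSDp W p :=
  _root_.Summit.BirchSwinnertonDyer.BirchSwinnertonDyer.Rank1Residual.bsdp_of_millerJetchev_of_index_le_tamagawa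
    hMJ hGZK W p hK hH hP hnt q hqN (ClassX6.not_hasCM W hX)
    hp2 hpD
    (fun h ↦ not_dvd_level_of_isHeegnerPoint_of_good W p hP hX.1.1 (dvd_trans (dvd_pow_self p two_ne_zero) h))
    (ClassX6.irr W p hp2 hX) hI hr hs hv

end Summit.BirchSwinnertonDyer.Rank1Residual.Supersingular

end
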